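import Summits.NavierStokesRegularity.NavierStokesRegularity.Theses.SqueezeCycle
import Summits.NavierStokesRegularity.NavierStokesRegularity.Theses.RecurrentProfiles
import Summits.NavierStokesRegularity.NavierStokesRegularity.Theses.AdaptedFrequency
import Literature.Dynamics.TopologicalDynamics.UniformRecurrence
import Literature.Analysis.FluidPDE.ScalingUniformRecurrence
import Summits.NavierStokesRegularity.NavierStokesRegularity.Theorems.SqueezeCycleRecurrentLiouvilleRecurrenceUpgrade
import Summits.NavierStokesRegularity.NavierStokesRegularity.Theorems.SqueezeCycleRecurrentLiouvilleConstOfTendsto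
import Summits.NavierStokesRegularity.NavierStokesRegularity.Theorems.SqueezeCycleRecurrentLiouvilleRecurrenceUpgradeOrbit
import Summits.NavierStokesRegularity.NavierStokesRegularity.Theorems.SqueezeCycleRecurrentLiouvilleSemiLyapunovRigidity
import Literature.Dynamics.TopologicalDynamics.MinimalOrbitClosure
import HarnessLib

/-!
# Crux `RecurrentLiouville` (stmt-NavierStokesRegularity-1589) — line `Ideator5Round2Sketch`, lead skeleton (re-seat a1)

Skeleton of line `Ideator5Round2Sketch` (card `Cruxes/RecurrentLiouville/Ideas/frequency-bridge-recurrence-upgrade.md`,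
sketch `Cruxes/RecurrentLiouville/Ideator5Round2Sketch.lean`, ideator 5 round 2), a declared BRIDGE:
`RecurrentLiouville ⟸ (class form of AdaptedFrequency's frequency convergence, in DEFECT form on the
hull) ∧ FrequencyRigidity (item stmt-NavierStokesRegularity-2955)`, with the RECURRENCE-UPGRADE LEMMAS of
topological dynamics as the load-bearing glue.

The crux (`Theses.SqueezeCycle.RecurrentLiouville` = `Theses.RecurrentProfiles.RecurrentLiouville`,
`Iff.rfl`): a suitable weak solution `(u, p)` of Navier–Stokes (`ν = 1`) on the backward slab
`(-∞,0) × ℝ³` with weak gradient `G`, Albritton–Barker `𝐈 < ⊤`, the rate `‖u‖ ≤ C/√(−t)` and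
UNIFORMLY RECURRENT under the scaling flow is regular at the origin.

## Registered stubs

* `stub_constOfTendstoOfRecurrent` (S1, abstract, [folklore]; LANDED p132685, imported): along a uniformly recurrent orbit of a
  jointly continuous `ℝ`-action, a continuous observable that converges as `s → +∞` is constant on the
  orbit ("convergent + recurrent ⇒ constant").
* `stub_recurrenceUpgrade` (S2, abstract, [folklore]; LANDED p132655, imported): on a compact phase space, a continuous
  observable `φ ≥ 0` whose forward time-integral along a uniformly recurrent orbit is finite vanishes
  at the base point ("integrable defect + recurrent ⇒ zero defect"; tube lemma + syndetic returns).
* `stub_frequencyDefectModel` (N1, Navier–Stokes side, the bridge's research-open stub): an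
  origin-singular, uniformly recurrent class profile carries (i) a classical representative `v` with a
  flow-adapted, two-sided Gaussian-comparable backward kernel `K` on `(-∞,0)` ending at `δ₀` (the
  ancient-class analogue of the PROVED item 2956 `AdaptedKernelExists`) with positive adapted enstrophy
  `H(t) = ∫ ‖curl v(t)‖² K(t)`, and (ii) a compact topological model `(X, ϕ, x₀)` of its scaling hull
  (jointly continuous `ℝ`-action, `x₀` uniformly recurrent) with a continuous non-negative DEFECT `D`
  (the Agmon–Nirenberg log-convexity defect of `log H` in log-time `s = −log(−t)`, read on the hull)
  that is INTEGRABLE along the forward orbit — AdaptedFrequency's bet, the class form of item 10493 —,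
  a continuous hull READOUT `Λh` of the adapted frequency `Λ(t) = (−t)H′/H` (`Λh (ϕ s x₀) = Λ(−e^{−s})`),
  and the LAW "zero defect on the hull ⇒ `Λ` monotone along the orbit" (exact log-convexity).  Typed in the vocabulary of `Theses.AdaptedFrequency.FrequencyRigidity` with `ν = 1`.
* tools (LANDED): `stub_recurrenceUpgradeTools` (`…RecurrenceUpgradeOrbit.lean`: the upgrade along the
  orbit and on the orbit closure) and `stub_semiLyapunovRigidityTools` (`…SemiLyapunovRigidity.lean`:
  a continuous functional monotone along a uniformly recurrent orbit of a compact system is constant on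
  the orbit closure — the crux docstring's "tool (a)"); Furstenberg 1981 Thm. 1.17 (orbit closure of a
  uniformly recurrent point is minimal) landed in `Literature/Dynamics/TopologicalDynamics/MinimalOrbitClosure.lean`.
* `stub_frequencyRigidity` (N2) = item stmt-NavierStokesRegularity-2955
  `Theses.AdaptedFrequency.FrequencyRigidity` VERBATIM (`stub_frequencyRigidity_iff`, `Iff.rfl`): no
  Type-I ancient classical flow with an adapted kernel has positive adapted enstrophy and CONSTANT
  adapted frequency.  OPEN (route AdaptedFrequency's crux).

## Composition `RecurrentLiouville_of`

By contradiction: N1 gives the model; S2, carried along the orbit and to its closure by the tools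
file (`stub_recurrenceUpgradeTools`: `isUniformlyRecurrentPt_act`, `integrableOn_Ici_orbit_act`,
`recurrenceUpgrade_closure`), kills the defect on the whole HULL `closure (range (ϕ · x₀))` (the
minimal set of `x₀`, `Literature…MinimalOrbitClosure`); the LAW makes `s ↦ Λh (ϕ s x₀)` monotone on
`ℝ`; semi-Lyapunov rigidity on the compact hull (`stub_semiLyapunovRigidityTools`, which packages S1)
makes it constant; the readout turns this into `Λ(t) = Λh x₀` for all `t < 0`; N2 excludes the
resulting datum `(1, C', Λh x₀, v, q, K)`.

By the standing Disproof (§A3 `recurrentLiouville_false_iff_typeISingularProfileExists`) and the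
certified residue of the dead line Sketch (`recurrentLiouville_iff_rellichScar`, p128754) the conjunction
N1 ∧ N2 is at least crux-hard; the line is a bridge giving the crux a second typed parent
(AdaptedFrequency) and its provable content is S1, S2.

## References

* H. Furstenberg, *Recurrence in Ergodic Theory and Combinatorial Number Theory* (1981), Ch. 1 §4.
* S. Agmon, L. Nirenberg, Comm. Pure Appl. Math. 16 (1963) (log-convexity).
* C.-C. Poon, Comm. PDE 21 (1996) (parabolic frequency).
* D. Albritton, T. Barker, J. Math. Fluid Mech. 21 (2019) = arXiv:1811.00502, Thm. 1.1, §3.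
-/

noncomputable section

-- the sub-problem namespace repeats the summit name (D-0017 layout `Summit.<S>.<P>.Theorems`)
set_option linter.dupNamespace false

namespace Summit.NavierStokesRegularity.NavierStokesRegularity.Theorems

open MeasureTheory Set Function Filter Topology TopologicalSpace Metric
open Literature.Analysis.FluidPDE
open Literature.Dynamics.TopologicalDynamics
open scoped NNReal ENNReal RealInnerProductSpace

/-! ## Stub S1 — convergent + recurrent ⇒ constant: LANDED (p132685)

`stub_constOfTendstoOfRecurrent` is the tree theorem
`Theorems/SqueezeCycleRecurrentLiouvilleConstOfTendsto.lean` (imported;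
`const_of_tendsto_of_isUniformlyRecurrentPt`, which needs neither `ϕ 0 = id` nor compactness). -/

/-! ## Stub S2 — the recurrence upgrade: LANDED (p132655)

`stub_recurrenceUpgrade` is the tree theorem
`Theorems/SqueezeCycleRecurrentLiouvilleRecurrenceUpgrade.lean` (imported; `recurrenceUpgrade_pt`,
`exists_tube_of_superlevel`). -/

/-! ## Stub N1 — the frequency-defect hull model (Navier–Stokes side; research-open) -/

/-- **Frequency-defect hull model** (registered stub N1; the bridge's Navier–Stokes stub).  For an
origin-singular class profile `(u, p, G, C)` (suitable weak on the slab, weak gradient, `𝐈 < ⊤`, rate,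
uniformly recurrent under scaling) there are: a classical representative `v = u` a.e. on the slab with
pressure `q`, the rate `C'`, and a flow-adapted backward kernel `K` on `(-∞,0)` ending at `δ₀`
(`C²`, `K > 0`, `∂ₜK + v·∇K + ΔK = 0`, unit mass, concentration at `0`, two-sided Gaussian-comparable —
the clauses of `Theses.AdaptedFrequency.FrequencyRigidity` with `ν = 1`; ancient-class analogue of the
PROVED item 2956); and a compact topological model `X` of the scaling hull with a jointly continuous
`ℝ`-action `ϕ`, a uniformly recurrent base point `x₀` (the profile itself), a continuous DEFECT
`D ≥ 0` integrable along the forward orbit (the Agmon–Nirenberg log-convexity defect of the adapted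
enstrophy in log-time — INTEGRABILITY IS THE RESEARCH-OPEN BET, the class form of item 10493
`AdaptedFrequencyConverges`), a continuous hull readout `Λh` of the adapted frequency
(`Λh (ϕ s x₀) = Λ(−e^{−s})`, `Λ = (−t)H′/H`, `H(t) = ∫‖curl v(t)‖²K(t) > 0`), and the exact
log-convexity LAW: zero defect on the hull (the orbit closure of `x₀`) makes `s ↦ Λh (ϕ s x₀)`
monotone on `ℝ` (no boundedness clause: the compact hull supplies it).  OPEN; by `recurrentLiouville_iff_rellichScar` (p128754) N1 ∧ N2 is at least crux-hard.
[cite: AgmonNirenberg1963; Poon1996; AlbrittonBarker2019, §3] -/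
theorem stub_frequencyDefectModel :
    ∀ (u : ℝ → EuclideanSpace ℝ (Fin 3) → EuclideanSpace ℝ (Fin 3)) (p : ℝ → EuclideanSpace ℝ (Fin 3) → ℝ) (G : ℝ → EuclideanSpace ℝ (Fin 3) → EuclideanSpace ℝ (Fin 3) →L[ℝ] EuclideanSpace ℝ (Fin 3)) (C : ℝ), Literature.Analysis.FluidPDE.IsSuitableWeakSolutionOn (Literature.Analysis.FluidPDE.slab (EuclideanSpace ℝ (Fin 3)) (Set.Iio 0) isOpen_Iio) 1 0 u p → Literature.Analysis.FluidPDE.HasWeakSpatialGradientOn (Literature.Analysis.FluidPDE.slab (EuclideanSpace ℝ (Fin 3)) (Set.Iio 0) isOpen_Iio) u G → Literature.Analysis.FluidPDE.typeIBound (Set.Iio (0 : ℝ) ×ˢ Set.univ) u p G < ⊤ → Literature.Analysis.FluidPDE.HasTypeITimeDecay C u → Literature.Analysis.FluidPDE.IsScalingUniformlyRecurrent u → Literature.Analysis.FluidPDE.IsBackwardSingularPoint u 0 → ∃ (C' : ℝ) (v : ℝ → EuclideanSpace ℝ (Fin 3) → EuclideanSpace ℝ (Fin 3)) (q : ℝ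 → EuclideanSpace ℝ (Fin 3) → ℝ) (K : ℝ → EuclideanSpace ℝ (Fin 3) → ℝ), (∀ᵐ z ∂(MeasureTheory.volume.restrict (Set.Iio (0:ℝ) ×ˢ (Set.univ : Set (EuclideanSpace ℝ (Fin 3))))), v z.1 z.2 = u z.1 z.2) ∧ Literature.Analysis.FluidPDE.IsClassicalNSSolutionOn (Set.Iio 0) 1 0 v q ∧ (∀ t ∈ Set.Iio (0:ℝ), ∀ x, ‖v t x‖ ≤ C' / Real.sqrt (-t)) ∧ ContDiffOn ℝ 2 (Function.uncurry K) (Set.Iio (0:ℝ) ×ˢ Set.univ) ∧ (∀ t ∈ Set.Iio (0:ℝ), ∀ x, 0 < K t x) ∧ (∀ t ∈ Set.Iio (0:ℝ), ∀ x, Literature.Analysis.FluidPDE.timeDerivWithin (Set.Iio (0:ℝ)) K t x + fderiv ℝ (K t) x (v t x) + 1 * Laplacian.laplacian (K t) x = 0) ∧ (∀ t ∈ Set.Iio (0:ℝ), ∫ x, K t x = 1) ∧ (∀ φ : EuclideanSpace ℝ (Fin 3) → ℝ, Continuous φ → (∃ M : ℝ, ∀ x, |φ x| ≤ M) → Filter.Tendsto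 (fun t => ∫ x, φ x * K t x) (nhdsWithin (0:ℝ) (Set.Iio (0:ℝ))) (nhds (φ (0 : EuclideanSpace ℝ (Fin 3))))) ∧ (∃ c₁ c₂ C₁ C₂ : ℝ, 0 < c₁ ∧ 0 < c₂ ∧ 0 < C₁ ∧ 0 < C₂ ∧ ∀ t ∈ Set.Iio (0:ℝ), ∀ x, c₁ * ((0:ℝ) - t) ^ (-(3:ℝ) / 2) * Real.exp (-(‖x - (0 : EuclideanSpace ℝ (Fin 3))‖ ^ 2) / (c₂ * ((0:ℝ) - t))) ≤ K t x ∧ K t x ≤ C₁ * ((0:ℝ) - t) ^ (-(3:ℝ) / 2) * Real.exp (-(‖x - (0 : EuclideanSpace ℝ (Fin 3))‖ ^ 2) / (C₂ * ((0:ℝ) - t)))) ∧ ∃ (X : Type) (_ : TopologicalSpace X) (_ : CompactSpace X) (ϕ : ℝ → X → X) (x₀ : X) (D Λh : X → ℝ), Continuous (fun p : ℝ × X => ϕ p.1 p.2) ∧ (∀ s t y, ϕ (s + t) y = ϕ s (ϕ t y)) ∧ (∀ y, ϕ 0 y = y) ∧ Literature.Dynamics.TopologicalDynamics.IsUniformlyRecurrentPt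 ϕ x₀ ∧ Continuous D ∧ (∀ y, 0 ≤ D y) ∧ Continuous Λh ∧ MeasureTheory.IntegrableOn (fun s => D (ϕ s x₀)) (Set.Ici 0) ∧ ((∀ y ∈ closure (Set.range fun s : ℝ => ϕ s x₀), D y = 0) → Monotone (fun s => Λh (ϕ s x₀))) ∧ ∀ H Λ : ℝ → ℝ, H = (fun t => ∫ x, ‖Literature.Analysis.FluidPDE.curl (v t) x‖ ^ 2 * K t x) → Λ = (fun t => (0 - t) * deriv H t / H t) → (∀ t ∈ Set.Iio (0:ℝ), 0 < H t) ∧ (∀ s : ℝ, Λh (ϕ s x₀) = Λ (-Real.exp (-s))) := by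
  sorry

/-! ## Stub N2 — frequency rigidity (= item stmt-NavierStokesRegularity-2955, OPEN) -/

/-- **Frequency rigidity** (registered stub N2; VERBATIM the crux item stmt-NavierStokesRegularity-2955
`Theses.AdaptedFrequency.FrequencyRigidity`): there is no smooth ancient Navier–Stokes flow `(v, q)`
on `(-∞,0) × ℝ³` (`ν > 0`) with the Type-I bound `‖v‖ ≤ C/√(−t)`, an adapted two-sided
Gaussian-comparable backward kernel `K` at `(0,0)`, positive adapted enstrophy and CONSTANT adapted
frequency.  OPEN (route AdaptedFrequency's crux; expected proof: equality case of log-convexity ⇒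
backward self-similar up to wobble ⇒ Tsai 1998 / NRŠ 1996). [cite: Tsai1998, Thm 1; NecasRuzickaSverak1996, Thm 1] -/
theorem stub_frequencyRigidity :
    ¬ ∃ (ν C Λ₀ : ℝ) (v : ℝ → EuclideanSpace ℝ (Fin 3) → EuclideanSpace ℝ (Fin 3)) (q : ℝ → EuclideanSpace ℝ (Fin 3) → ℝ) (K : ℝ → EuclideanSpace ℝ (Fin 3) → ℝ), 0 < ν ∧ Literature.Analysis.FluidPDE.IsClassicalNSSolutionOn (Set.Iio 0) ν 0 v q ∧ (∀ t ∈ Set.Iio (0:ℝ), ∀ x, ‖v t x‖ ≤ C / Real.sqrt (-t)) ∧ ContDiffOn ℝ 2 (Function.uncurry K) (Set.Iio (0:ℝ) ×ˢ Set.univ) ∧ (∀ t ∈ Set.Iio (0:ℝ), ∀ x, 0 < K t x) ∧ (∀ t ∈ Set.Iio (0:ℝ), ∀ x, Literature.Analysis.FluidPDE.timeDerivWithin (Set.Iio (0:ℝ)) K t x + fderiv ℝ (K t) x (v t x) + ν * Laplacian.laplacian (K t) x = 0) ∧ (∀ t ∈ Set.Iio (0:ℝ), ∫ x, K t x = 1)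 ∧ (∀ φ : EuclideanSpace ℝ (Fin 3) → ℝ, Continuous φ → (∃ M : ℝ, ∀ x, |φ x| ≤ M) → Filter.Tendsto (fun t => ∫ x, φ x * K t x) (nhdsWithin (0:ℝ) (Set.Iio (0:ℝ))) (nhds (φ (0 : EuclideanSpace ℝ (Fin 3))))) ∧ (∃ c₁ c₂ C₁ C₂ : ℝ, 0 < c₁ ∧ 0 < c₂ ∧ 0 < C₁ ∧ 0 < C₂ ∧ ∀ t ∈ Set.Iio (0:ℝ), ∀ x, c₁ * ((0:ℝ) - t) ^ (-(3:ℝ) / 2) * Real.exp (-(‖x - (0 : EuclideanSpace ℝ (Fin 3))‖ ^ 2) / (c₂ * ((0:ℝ) - t))) ≤ K t x ∧ K t x ≤ C₁ * ((0:ℝ) - t) ^ (-(3:ℝ) / 2) * Real.exp (-(‖x - (0 : EuclideanSpace ℝ (Fin 3))‖ ^ 2) / (C₂ * ((0:ℝ) - t)))) ∧ (∀ H Λ : ℝ → ℝ, H = (fun t => ∫ x, ‖Literature.Analysis.FluidPDE.curl (v t) x‖ ^ 2 * K t x) → Λ = (fun t => (0 - t) * deriv H t / H t) → (∀ t ∈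 Set.Iio (0:ℝ), 0 < H t) ∧ (∀ t ∈ Set.Iio (0:ℝ), Λ t = Λ₀)) := by
  sorry

/-- The stub is letter for letter the AdaptedFrequency crux decl (so it closes BY NAME when route
AdaptedFrequency appends `FrequencyRigidity_holds`). -/
theorem stub_frequencyRigidity_iff :
    type_of% stub_frequencyRigidity ↔ Theses.AdaptedFrequency.FrequencyRigidity :=
  Iff.rfl

/-! ## Composition -/

/-- **The crux from the stubs** (by contradiction).  N1 supplies the classical representative with
its adapted kernel and the compact hull model; S2, carried to the orbit closure by the tools stub
`stub_recurrenceUpgradeTools`, kills the integrable defect on the whole hull; the exact log-convexity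
law makes the frequency readout monotone along the orbit; semi-Lyapunov rigidity
(`stub_semiLyapunovRigidityTools`, i.e. S1 + compactness) makes it constant, so `Λ(t) = Λ₀ := Λh x₀`
for all `t < 0`; N2 excludes the datum `(ν, C, Λ₀, v, q, K) = (1, C', Λh x₀, v, q, K)`. -/
theorem RecurrentLiouville_of : Theses.SqueezeCycle.RecurrentLiouville := by
  intro u p G C hsw hwg hI hdec hrec hsing
  obtain ⟨C', v, q, K, _hae, hcl, hrate, hK2, hKpos, hKeq, hKmass, hKconc, hKgauss, X, _i1, _i2, ϕ, x₀,
      D, Λh, hcont, hadd, h0, hx₀, hDc, hD0, hΛc, hint, hlaw, hread⟩ :=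
    stub_frequencyDefectModel u p G C hsw hwg hI hdec hrec hsing
  -- zero defect on the whole hull (recurrence upgrade S2, carried to the orbit closure by the tools
  -- stub `stub_recurrenceUpgradeTools`: each orbit point is again uniformly recurrent with
  -- integrable forward tail, and `{D = 0}` is closed; universes pinned to `0`, the model lives in `Type`)
  have hzero : ∀ y ∈ closure (Set.range fun s : ℝ => ϕ s x₀), D y = 0 :=
    (stub_recurrenceUpgradeTools.{0, 0}).2 ϕ hcont hadd h0 D hDc hD0 x₀ hx₀ hint
  -- exact log-convexity: the frequency readout is monotone along the orbit, hence (semi-Lyapunov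
  -- rigidity on the compact hull, tools stub `stub_semiLyapunovRigidityTools`, built on S1) constant
  have hconst : ∀ s : ℝ, Λh (ϕ s x₀) = Λh x₀ := fun s =>
    (stub_semiLyapunovRigidityTools.{0, 0}).2 ϕ hcont hadd h0 Λh hΛc x₀ hx₀ (hlaw hzero) (ϕ s x₀)
      (subset_closure ⟨s, rfl⟩)
  -- frequency rigidity excludes the datum
  refine stub_frequencyRigidity ⟨1, C', Λh x₀, v, q, K, one_pos, hcl, hrate, hK2, hKpos, hKeq, hKmass,
    hKconc, hKgauss, fun H Λ hH hΛ => ?_⟩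
  obtain ⟨hHpos, hr⟩ := hread H Λ hH hΛ
  refine ⟨hHpos, fun t ht => ?_⟩
  have ht' : 0 < -t := neg_pos.2 ht
  have h1 := hr (-Real.log (-t))
  rw [neg_neg, Real.exp_log ht', neg_neg, hconst] at h1
  exact h1.symm

/-- **The crux in its RecurrentProfiles copy** (the two route copies agree letter for letter,
`Iff.rfl`; the item stmt-NavierStokesRegularity-1589 is shared by both routes). -/
theorem RecurrentLiouville_proof : Theses.RecurrentProfiles.RecurrentLiouville :=
  RecurrentLiouville_of

end Summit.NavierStokesRegularity.NavierStokesRegularity.Theorems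

end
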